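/-
Copyright (c) 2026 the pub-hodgecm-mathlib formalisation cell (harness21).  Prover seat hodgecm-mathlib-K2-defs1 (g5): Track B «K2-LIT», E1 desk hand,
h413 = stmt-HodgeConjecture-24833; (q10) «R7₃-SCALAR» FILE 3, brick (3-ii) «LOCAL MEAN SPLIT» (dealer K2E1-plan (g5) 2026-09-04T08:28:47Z; consumer K2E2-p12 (g5)).
-/
import Summits.HodgeConjecture.HodgeConjecture.Theorems.K2E1GindikinKarpelevichSplitGL3Haar   -- ★ (K2E3-p12 g5): `integrable_bigCellIntegrand`, `integral_prod_bigCell_spherical_gl3_eq` on `F × (F × F)`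
import Summits.HodgeConjecture.HodgeConjecture.Theorems.K2E1BigCellCoordinateChangeGL3        -- ★ (K2E2-p12 g5): `measurePreserving_bigCellChange`, `integral_comp_bigCellChange_eq` on `Fin 3 → F`
import Summits.HodgeConjecture.HodgeConjecture.Theorems.K2E1IntertwiningLocalFactorU3        -- ★ (K2E2-p12 g5): `localScalar_shape_one_eq` (FILE 1's `ε = +1` tokens)
import Mathlib.MeasureTheory.Integral.Pi
import HarnessLib

/-!
# K2·E1 — `K2E1IntertwiningLocalMeanSplitU3` ((q10) «R7₃-SCALAR» FILE 3, brick (3-ii)): THE SPLIT LOCAL MEAN AS A PRODUCT-MEASURE INTEGRAL ON `Fin 3 → F` —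
# `∫ (max(1,|x|,|z|)·max(1,|y|,|z−xy|))^{−σ}` at `(x,y,z) = (a + δ₁b, −(a − δ₁b), δ₁t − ½(a+δ₁b)(a−δ₁b))` `d(μ⊗μ⊗μ)(a,b,t) = μ(𝒪)³·((1−q^{−σ})∕(1−q^{1−σ}))²·(1−q^{−(2σ−1)})∕(1−q^{−(2σ−2)})`, `σ > 1`

Track B ∕ K2-LIT, crux h413 = `stmt-HodgeConjecture-24833`, route of record `HCCMUnconditional`; cell `hodgecm-mathlib`, squad K2, ENGINE E1 (campaign «EIS-RANK-ONE», R7 at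
`N = 3`).  THEOREMS ONLY (no `def`, no instance, no notation, no named-fact hypothesis, no `sorry`; default heartbeats); lane `--supports stmt-HodgeConjecture-24833 --as helper`
(count-neutral).  The SPLIT twin of ★ (3-i) `K2E1IntertwiningLocalMeanInertU3` (K2E2-p12 g5, the template): generic non-archimedean local field `F` (= `L⁺_v` at a place `v` split in
`L`), ANY additive Haar `μ`, currency `Measure.pi (fun _ : Fin 3 => μ)` on `Fin 3 → F` — the local factors of ★ `AdelicProductIntegral` at `ι = Fin 3` (after ★ `K2E1FiniteAdeleBasisTransport`)
are GENUINE product-measure integrals; `δ₁ = δ_w` with `‖δ₁‖ = ‖2‖ = 1` (the place is off `S ⊇ S_δ ∪ {v ∣ 2}`).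

THE MATHEMATICS [Langlands1971, §3; TateThesis1967, §3.3; MoeglinWaldspurger1995, II.1.7].  Everything is ★; this brick only MOVES it onto `(Fin 3 → F, μ³)`.
(§1) The GK integrand in `Fin 3`-letters, `G(q) := max(1,‖q₀‖,‖q₂‖)^{−σ}·max(1,‖q₁‖,‖q₂ − q₀q₁‖)^{−σ}` (order `(x, y, z) = (q₀, q₁, q₂)`, the OUTPUT order of ★ `K2E1BigCellCoordinateChangeGL3`'s
vector), is `g_GK ∘ E` for the measurable equivalence `E : (Fin 3 → F) ≃ᵐ F × (F × F)`, `E q = (q₀, (q₂, q₁))` (Mathlib `piFinSuccAbove 0`, `finTwoArrow`, `Prod.swap`), which carries `μ³` to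
`μ ⊗ (μ ⊗ μ)`; so ★ `K2E1GindikinKarpelevichSplitGL3Haar` (`integrable_bigCellIntegrand`, `integral_prod_bigCell_spherical_gl3_eq`, coordinates `(x,(z,y))`) gives **`Integrable G μ³`** and
**`∫ G dμ³ = μ(𝒪)³·((1−q^{−σ})∕(1−q^{1−σ}))²·(1−q^{−(2σ−1)})∕(1−q^{−(2σ−2)})`** for `σ > 1`.  (§2) BASE COORDINATES: ★ `measurePreserving_bigCellChange` ∕ `integral_comp_bigCellChange_eq`
(`Φ(a,b,t) = (a + δ₁b, −(a − δ₁b), δ₁t − ½(a+δ₁b)(a−δ₁b))` preserves `μ³` when `‖2‖ = ‖δ₁‖ = 1`) transport both statements to the integrand `G ∘ Φ` — which, by ★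
`K2E1IntertwiningLocalFactorU3HeightSplit.prod_placesOver_max_one_norm_height_eq_gl3_of_split`, IS the split height factor `∏_{w∣v} max(1,‖X_w‖,‖Z_w‖)` of the `U(2,1)` big cell read in the
base coordinates `(a, b, t) ∈ (L⁺_v)³`.  (§3) The FILE-1 token form (`ε = +1`, ★ `localScalar_shape_one_eq`), the single-power form `(max·max)^{−σ}` (`Real.mul_rpow`), and the `((· : ℝ) : ℂ)` twin
for ★ `AdelicProductIntegral`'s `ℂ`-valued local factors.

* §1 `continuous_gkCell`, **`integrable_gkCell_pi`**, **`integral_gkCell_pi_eq`** (GK letters on `Fin 3 → F`).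
* §2 **`integrable_splitCell_pi`**, **`integral_splitCell_pi_eq`** (base coordinates, `‖δ₁‖ = ‖2‖ = 1`), `integral_splitCell_pi_eq_localScalar` (`ε = +1` tokens).
* §3 `gkCell_eq_mul_rpow` (single power ↔ product of powers), `integral_splitCell_pi_eq'` (single-power form), **`integral_splitCell_pi_ofReal_eq`** (`ℂ` currency: `Integrable ∧ ∫ = ↑(closed form)`).
HONEST LABEL: HC_CM is proved only modulo the 7 printed citations (2 remaining named inputs: hLiu418 = `stmt-HodgeConjecture-24832`, h413 = `stmt-HodgeConjecture-24833`) until rung 0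
closes; this file asserts no named fact and closes no socket; count-neutral.

## References
* [Langlands1971] R. P. Langlands, *Euler Products* (1971): §3.
* [TateThesis1967] J. Tate, in Cassels–Fröhlich (1967), Ch. XV §3.3 (local factors as integrals over `K_v^n`).
* [MoeglinWaldspurger1995] C. Mœglin, J.-L. Waldspurger, *Spectral Decomposition and Eisenstein Series* (1995): II.1.7, IV.1.11.
-/

set_option autoImplicit false
set_option linter.dupNamespace false -- the mandated namespace repeats `HodgeConjecture.HodgeConjecture`

noncomputable section

open MeasureTheory MeasureTheory.Measure Filter Topology Set
open scoped NNReal ENNReal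
open Literature.NumberTheory.GaloisRepresentations Literature.NumberTheory.GaloisRepresentations.IsNonarchimedeanLocalField
open Literature.NumberTheory.Automorphic Literature.NumberTheory.Automorphic.LocalFieldHaar
open Summit.HodgeConjecture.HodgeConjecture.Cruxes.H413.K2E1GindikinKarpelevichSplitGL3Haar (continuous_bigCellIntegrand integrable_bigCellIntegrand integral_prod_bigCell_spherical_gl3_eq)
open Summit.HodgeConjecture.HodgeConjecture.Cruxes.H413.K2E1BigCellCoordinateChangeGL3 (measurePreserving_bigCellChange integral_comp_bigCellChange_eq)
open Summit.HodgeConjecture.HodgeConjecture.Cruxes.H413.K2E1IntertwiningLocalFactorU3 (localScalar_shape_one_eq)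

namespace Summit.HodgeConjecture.HodgeConjecture.Cruxes.H413.K2E1IntertwiningLocalMeanSplitU3

variable {F : Type*} [Field F] [ValuativeRel F] [TopologicalSpace F] [IsNonarchimedeanLocalField F]

/-! ## §1 The Gindikin–Karpelevich integrand on `(Fin 3 → F, μ³)` -/

/-- `G(q) = max(1,‖q₀‖,‖q₂‖)^{−σ}·max(1,‖q₁‖,‖q₂ − q₀q₁‖)^{−σ}` is continuous on `Fin 3 → F` (★ `continuous_bigCellIntegrand` along `q ↦ (q₀,(q₂,q₁))`). [folklore] -/
theorem continuous_gkCell (σ : ℝ) :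
    Continuous fun q : Fin 3 → F => (max 1 (max ((normAbs F (q 0) : ℝ≥0) : ℝ) ((normAbs F (q 2) : ℝ≥0) : ℝ))) ^ (-σ) *
      (max 1 (max ((normAbs F (q 1) : ℝ≥0) : ℝ) ((normAbs F (q 2 - q 0 * q 1) : ℝ≥0) : ℝ))) ^ (-σ) := by
  have h : Continuous fun t : F => ((normAbs F t : ℝ≥0) : ℝ) := NNReal.continuous_coe.comp continuous_normAbs
  refine Continuous.mul ?_ ?_
  · exact (continuous_const.max ((h.comp (continuous_apply 0)).max (h.comp (continuous_apply 2)))).rpow_const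
      fun q => Or.inl (one_pos.trans_le (le_max_left _ _)).ne'
  · exact (continuous_const.max ((h.comp (continuous_apply 1)).max
      (h.comp ((continuous_apply 2).sub ((continuous_apply 0).mul (continuous_apply 1)))))).rpow_const
      fun q => Or.inl (one_pos.trans_le (le_max_left _ _)).ne' 

section Haar

variable [MeasurableSpace F] [BorelSpace F] (μ : Measure F) [μ.IsAddHaarMeasure]

omit [BorelSpace F] in
/-- The coordinate equivalence `E : (Fin 3 → F) ≃ᵐ F × (F × F)`, `E q = (q₀, (q₂, q₁))`, carries `μ³` to `μ ⊗ (μ ⊗ μ)`, and pulls the ★ GK integrand (coordinates `(x,(z,y))`) back to `G`: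
packaged as «`∃ E` measure-preserving with `g_GK ∘ E = G`» (Mathlib `piFinSuccAbove`, `finTwoArrow`, `Prod.swap`). [cite: TateThesis1967, §3.3] -/
theorem exists_measurePreserving_gkCell (σ : ℝ) :
    ∃ E : (Fin 3 → F) ≃ᵐ F × (F × F), MeasurePreserving E (Measure.pi fun _ : Fin 3 => μ) (μ.prod (μ.prod μ)) ∧
      ∀ q : Fin 3 → F, (max 1 (max ((normAbs F (E q).1 : ℝ≥0) : ℝ) ((normAbs F (E q).2.1 : ℝ≥0) : ℝ))) ^ (-σ) *
          (max 1 (max ((normAbs F (E q).2.2 : ℝ≥0) : ℝ) ((normAbs F ((E q).2.1 - (E q).1 * (E q).2.2) : ℝ≥0) : ℝ))) ^ (-σ) =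
        (max 1 (max ((normAbs F (q 0) : ℝ≥0) : ℝ) ((normAbs F (q 2) : ℝ≥0) : ℝ))) ^ (-σ) *
          (max 1 (max ((normAbs F (q 1) : ℝ≥0) : ℝ) ((normAbs F (q 2 - q 0 * q 1) : ℝ≥0) : ℝ))) ^ (-σ) := by
  haveI := secondCountableTopology_localField F
  haveI := sigmaCompactSpace_of_isNonarchimedeanLocalField F
  -- `e₁ : (Fin 3 → F) ≃ᵐ F × (Fin 2 → F)` (separate coordinate 0), `e₂ : (Fin 2 → F) ≃ᵐ F × F`, then swap the inner pair
  set e₁ : (Fin 3 → F) ≃ᵐ F × (Fin 2 → F) := MeasurableEquiv.piFinSuccAbove (fun _ : Fin 3 => F) 0 with he₁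
  have h₁ : MeasurePreserving e₁ (Measure.pi fun _ : Fin 3 => μ) (μ.prod (Measure.pi fun _ : Fin 2 => μ)) := measurePreserving_piFinSuccAbove (fun _ : Fin 3 => μ) 0
  have h₂ : MeasurePreserving (MeasurableEquiv.finTwoArrow (α := F)) (Measure.pi fun _ : Fin 2 => μ) (μ.prod μ) := measurePreserving_finTwoArrow μ
  have h₃ : MeasurePreserving (MeasurableEquiv.prodComm (α := F) (β := F)) (μ.prod μ) (μ.prod μ) := measurePreserving_swap
  set E : (Fin 3 → F) ≃ᵐ F × (F × F) := e₁.trans (MeasurableEquiv.prodCongr (MeasurableEquiv.refl F) ((MeasurableEquiv.finTwoArrow (α := F)).trans (MeasurableEquiv.prodComm (α := F) (β := F)))) with hE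
  have hEmp : MeasurePreserving E (Measure.pi fun _ : Fin 3 => μ) (μ.prod (μ.prod μ)) :=
    ((MeasurePreserving.id μ).prod (h₃.comp h₂)).comp h₁
  refine ⟨E, hEmp, fun q => ?_⟩
  have hq1 : (E q).1 = q 0 := rfl
  have hq21 : (E q).2.1 = q 2 := rfl
  have hq22 : (E q).2.2 = q 1 := rfl
  rw [hq1, hq21, hq22]

/-- **`G` IS `μ³`-INTEGRABLE for `σ > 1`** (★ `integrable_bigCellIntegrand` transported along `E`). [cite: Langlands1971, §3] [cite: TateThesis1967, §3.3] -/
theorem integrable_gkCell_pi {σ : ℝ} (hσ : 1 < σ) :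
    Integrable (fun q : Fin 3 → F => (max 1 (max ((normAbs F (q 0) : ℝ≥0) : ℝ) ((normAbs F (q 2) : ℝ≥0) : ℝ))) ^ (-σ) *
      (max 1 (max ((normAbs F (q 1) : ℝ≥0) : ℝ) ((normAbs F (q 2 - q 0 * q 1) : ℝ≥0) : ℝ))) ^ (-σ)) (Measure.pi fun _ : Fin 3 => μ) := by
  obtain ⟨E, hE, hEq⟩ := exists_measurePreserving_gkCell μ σ
  have h := (hE.integrable_comp_emb E.measurableEmbedding (g := fun p : F × (F × F) =>
    (max 1 (max ((normAbs F p.1 : ℝ≥0) : ℝ) ((normAbs F p.2.1 : ℝ≥0) : ℝ))) ^ (-σ) * (max 1 (max ((normAbs F p.2.2 : ℝ≥0) : ℝ) ((normAbs F (p.2.1 - p.1 * p.2.2) : ℝ≥0) : ℝ))) ^ (-σ))).mpr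
    (integrable_bigCellIntegrand μ hσ)
  refine h.congr (Eventually.of_forall fun q => ?_)
  exact hEq q

/-- **`∫ G dμ³ = μ(𝒪)³·((1−q^{−σ})∕(1−q^{1−σ}))²·(1−q^{−(2σ−1)})∕(1−q^{−(2σ−2)})`** for `σ > 1` (★ `integral_prod_bigCell_spherical_gl3_eq` transported along `E`).
[cite: Langlands1971, §3] [cite: MoeglinWaldspurger1995, II.1.7] -/
theorem integral_gkCell_pi_eq {σ : ℝ} (hσ : 1 < σ) :
    ∫ q : Fin 3 → F, (max 1 (max ((normAbs F (q 0) : ℝ≥0) : ℝ) ((normAbs F (q 2) : ℝ≥0) : ℝ))) ^ (-σ) *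
        (max 1 (max ((normAbs F (q 1) : ℝ≥0) : ℝ) ((normAbs F (q 2 - q 0 * q 1) : ℝ≥0) : ℝ))) ^ (-σ) ∂(Measure.pi fun _ : Fin 3 => μ) =
      μ.real (primePowBall F 0) ^ 3 *
        (((1 - (residueFieldCard F : ℝ) ^ (-σ)) / (1 - (residueFieldCard F : ℝ) ^ (1 - σ))) ^ 2 *
          ((1 - (residueFieldCard F : ℝ) ^ (-(2 * σ - 1))) / (1 - (residueFieldCard F : ℝ) ^ (-(2 * σ - 2))))) := by
  obtain ⟨E, hE, hEq⟩ := exists_measurePreserving_gkCell μ σ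
  rw [← integral_prod_bigCell_spherical_gl3_eq μ hσ, ← hE.integral_comp']
  exact integral_congr_ae (Eventually.of_forall fun q => (hEq q).symm)

/-! ## §2 Base coordinates: the split local mean `∫ G(Φ(a,b,t)) dμ³` -/

/-- **THE SPLIT LOCAL INTEGRAND IS `μ³`-INTEGRABLE** (`σ > 1`, `‖δ₁‖ = ‖2‖ = 1`): `(a,b,t) ↦ G(a + δ₁b, −(a − δ₁b), δ₁t − ½(a+δ₁b)(a−δ₁b))` (★ `measurePreserving_bigCellChange` +
§1). [cite: Langlands1971, §3] [cite: TateThesis1967, §3.3] -/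
theorem integrable_splitCell_pi {δ₁ : F} (hδ : normAbs F δ₁ = 1) (h2 : normAbs F 2 = 1) {σ : ℝ} (hσ : 1 < σ) :
    Integrable (fun p : Fin 3 → F =>
      (fun q : Fin 3 → F => (max 1 (max ((normAbs F (q 0) : ℝ≥0) : ℝ) ((normAbs F (q 2) : ℝ≥0) : ℝ))) ^ (-σ) *
        (max 1 (max ((normAbs F (q 1) : ℝ≥0) : ℝ) ((normAbs F (q 2 - q 0 * q 1) : ℝ≥0) : ℝ))) ^ (-σ))
        ![p 0 + δ₁ * p 1, -(p 0 - δ₁ * p 1), δ₁ * p 2 - 2⁻¹ * (p 0 + δ₁ * p 1) * (p 0 - δ₁ * p 1)]) (Measure.pi fun _ : Fin 3 => μ) :=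
  (measurePreserving_bigCellChange μ hδ h2).integrable_comp_of_integrable (integrable_gkCell_pi μ hσ)

/-- **THE SPLIT LOCAL MEAN, CLOSED FORM** (`σ > 1`, `‖δ₁‖ = ‖2‖ = 1`):
`∫ G(a + δ₁b, −(a − δ₁b), δ₁t − ½(a+δ₁b)(a−δ₁b)) dμ³(a,b,t) = μ(𝒪)³·((1−q^{−σ})∕(1−q^{1−σ}))²·(1−q^{−(2σ−1)})∕(1−q^{−(2σ−2)})` (★ `integral_comp_bigCellChange_eq` + §1).
[cite: Langlands1971, §3] [cite: MoeglinWaldspurger1995, II.1.7] -/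
theorem integral_splitCell_pi_eq {δ₁ : F} (hδ : normAbs F δ₁ = 1) (h2 : normAbs F 2 = 1) {σ : ℝ} (hσ : 1 < σ) :
    ∫ p : Fin 3 → F, (fun q : Fin 3 → F => (max 1 (max ((normAbs F (q 0) : ℝ≥0) : ℝ) ((normAbs F (q 2) : ℝ≥0) : ℝ))) ^ (-σ) *
        (max 1 (max ((normAbs F (q 1) : ℝ≥0) : ℝ) ((normAbs F (q 2 - q 0 * q 1) : ℝ≥0) : ℝ))) ^ (-σ))
        ![p 0 + δ₁ * p 1, -(p 0 - δ₁ * p 1), δ₁ * p 2 - 2⁻¹ * (p 0 + δ₁ * p 1) * (p 0 - δ₁ * p 1)] ∂(Measure.pi fun _ : Fin 3 => μ) =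
      μ.real (primePowBall F 0) ^ 3 *
        (((1 - (residueFieldCard F : ℝ) ^ (-σ)) / (1 - (residueFieldCard F : ℝ) ^ (1 - σ))) ^ 2 *
          ((1 - (residueFieldCard F : ℝ) ^ (-(2 * σ - 1))) / (1 - (residueFieldCard F : ℝ) ^ (-(2 * σ - 2))))) := by
  have h := integral_comp_bigCellChange_eq μ hδ h2 (fun q : Fin 3 → F => (max 1 (max ((normAbs F (q 0) : ℝ≥0) : ℝ) ((normAbs F (q 2) : ℝ≥0) : ℝ))) ^ (-σ) *
    (max 1 (max ((normAbs F (q 1) : ℝ≥0) : ℝ) ((normAbs F (q 2 - q 0 * q 1) : ℝ≥0) : ℝ))) ^ (-σ))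
  rw [h, integral_gkCell_pi_eq μ hσ]

omit [MeasurableSpace F] [BorelSpace F] in
/-- **THE EXPLICIT BASE-COORDINATE INTEGRAND** (the vector of ★ bigCellChange beta-reduced: `Matrix.cons_val_*`): for every `p`,
`G(Φ p) = max(1,‖p₀+δ₁p₁‖,‖δ₁p₂ − ½(p₀+δ₁p₁)(p₀−δ₁p₁)‖)^{−σ}·max(1,‖−(p₀−δ₁p₁)‖,‖(δ₁p₂ − ½(p₀+δ₁p₁)(p₀−δ₁p₁)) − (p₀+δ₁p₁)·(−(p₀−δ₁p₁))‖)^{−σ}` — the letters of ★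
`K2E1IntertwiningLocalFactorU3HeightSplit.prod_placesOver_max_one_norm_height_eq_gl3_of_split` up to `Real.mul_rpow`. [folklore] -/
theorem gkCell_bigCellChange_apply (δ₁ : F) (σ : ℝ) (p : Fin 3 → F) :
    (fun q : Fin 3 → F => (max 1 (max ((normAbs F (q 0) : ℝ≥0) : ℝ) ((normAbs F (q 2) : ℝ≥0) : ℝ))) ^ (-σ) *
        (max 1 (max ((normAbs F (q 1) : ℝ≥0) : ℝ) ((normAbs F (q 2 - q 0 * q 1) : ℝ≥0) : ℝ))) ^ (-σ))
        ![p 0 + δ₁ * p 1, -(p 0 - δ₁ * p 1), δ₁ * p 2 - 2⁻¹ * (p 0 + δ₁ * p 1) * (p 0 - δ₁ * p 1)] =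
      (max 1 (max ((normAbs F (p 0 + δ₁ * p 1) : ℝ≥0) : ℝ) ((normAbs F (δ₁ * p 2 - 2⁻¹ * (p 0 + δ₁ * p 1) * (p 0 - δ₁ * p 1)) : ℝ≥0) : ℝ))) ^ (-σ) *
        (max 1 (max ((normAbs F (-(p 0 - δ₁ * p 1)) : ℝ≥0) : ℝ)
          ((normAbs F (δ₁ * p 2 - 2⁻¹ * (p 0 + δ₁ * p 1) * (p 0 - δ₁ * p 1) - (p 0 + δ₁ * p 1) * (-(p 0 - δ₁ * p 1))) : ℝ≥0) : ℝ))) ^ (-σ) := by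
  simp only [Matrix.cons_val_zero, Matrix.cons_val_one, Matrix.cons_val_two, Matrix.head_cons, Matrix.tail_cons]

/-- **THE SAME IN FILE 1's TOKENS** (`ε = +1`): `μ(𝒪)³ · [(1 − q^{−σ})(1 − ε q^{−σ})(1 − ε q^{−(2σ−1)})] ∕ [(1 − q^{−(σ−1)})(1 − ε q^{−(σ−1)})(1 − ε q^{−(2σ−2)})]` (★ `localScalar_shape_one_eq`).
[cite: MoeglinWaldspurger1995, IV.1.11] -/
theorem integral_splitCell_pi_eq_localScalar {δ₁ : F} (hδ : normAbs F δ₁ = 1) (h2 : normAbs F 2 = 1) {σ : ℝ} (hσ : 1 < σ) :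
    ∫ p : Fin 3 → F, (fun q : Fin 3 → F => (max 1 (max ((normAbs F (q 0) : ℝ≥0) : ℝ) ((normAbs F (q 2) : ℝ≥0) : ℝ))) ^ (-σ) *
        (max 1 (max ((normAbs F (q 1) : ℝ≥0) : ℝ) ((normAbs F (q 2 - q 0 * q 1) : ℝ≥0) : ℝ))) ^ (-σ))
        ![p 0 + δ₁ * p 1, -(p 0 - δ₁ * p 1), δ₁ * p 2 - 2⁻¹ * (p 0 + δ₁ * p 1) * (p 0 - δ₁ * p 1)] ∂(Measure.pi fun _ : Fin 3 => μ) =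
      μ.real (primePowBall F 0) ^ 3 *
        ((1 - (residueFieldCard F : ℝ) ^ (-σ)) * (1 - 1 * (residueFieldCard F : ℝ) ^ (-σ)) * (1 - 1 * (residueFieldCard F : ℝ) ^ (-(2 * σ - 1))) /
          ((1 - (residueFieldCard F : ℝ) ^ (-(σ - 1))) * (1 - 1 * (residueFieldCard F : ℝ) ^ (-(σ - 1))) * (1 - 1 * (residueFieldCard F : ℝ) ^ (-(2 * σ - 2))))) := by
  rw [integral_splitCell_pi_eq μ hδ h2 hσ, localScalar_shape_one_eq (residueFieldCard F : ℝ) σ]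

/-! ## §3 Currencies: single power, and `ℂ` -/

omit [ValuativeRel F] [TopologicalSpace F] [IsNonarchimedeanLocalField F] [MeasurableSpace F] [BorelSpace F] in
/-- Single power ↔ product of powers: `(A·B)^{−σ} = A^{−σ}·B^{−σ}` for the two (non-negative) floors. [folklore] -/
theorem mul_rpow_neg_max_one {A B : ℝ} (hA : 1 ≤ A) (hB : 1 ≤ B) (σ : ℝ) : (A * B) ^ (-σ) = A ^ (-σ) * B ^ (-σ) :=
  Real.mul_rpow (zero_le_one.trans hA) (zero_le_one.trans hB)

/-- **SINGLE-POWER FORM** of the split local mean (the integrand as `(max(1,|x|,|z|)·max(1,|y|,|z−xy|))^{−σ}` at `Φ p`, ★ HeightSplit's shape): same closed form.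
[cite: Langlands1971, §3] [cite: MoeglinWaldspurger1995, II.1.7] -/
theorem integral_splitCell_pi_eq' {δ₁ : F} (hδ : normAbs F δ₁ = 1) (h2 : normAbs F 2 = 1) {σ : ℝ} (hσ : 1 < σ) :
    ∫ p : Fin 3 → F, (fun q : Fin 3 → F => (max 1 (max ((normAbs F (q 0) : ℝ≥0) : ℝ) ((normAbs F (q 2) : ℝ≥0) : ℝ)) *
        max 1 (max ((normAbs F (q 1) : ℝ≥0) : ℝ) ((normAbs F (q 2 - q 0 * q 1) : ℝ≥0) : ℝ))) ^ (-σ))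
        ![p 0 + δ₁ * p 1, -(p 0 - δ₁ * p 1), δ₁ * p 2 - 2⁻¹ * (p 0 + δ₁ * p 1) * (p 0 - δ₁ * p 1)] ∂(Measure.pi fun _ : Fin 3 => μ) =
      μ.real (primePowBall F 0) ^ 3 *
        (((1 - (residueFieldCard F : ℝ) ^ (-σ)) / (1 - (residueFieldCard F : ℝ) ^ (1 - σ))) ^ 2 *
          ((1 - (residueFieldCard F : ℝ) ^ (-(2 * σ - 1))) / (1 - (residueFieldCard F : ℝ) ^ (-(2 * σ - 2))))) := by
  rw [← integral_splitCell_pi_eq μ hδ h2 hσ]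
  refine integral_congr_ae (Eventually.of_forall fun p => ?_)
  exact mul_rpow_neg_max_one (le_max_left _ _) (le_max_left _ _) σ

/-- **COMPLEX CURRENCY** (the local factors of ★ `AdelicProductIntegral` are `ℂ`-valued): integrability of `((G ∘ Φ : ℝ) : ℂ)` and `∫ ↑(G(Φ p)) dμ³ = ↑(closed form)`.
[cite: TateThesis1967, §3.3] [cite: Langlands1971, §3] -/
theorem integral_splitCell_pi_ofReal_eq {δ₁ : F} (hδ : normAbs F δ₁ = 1) (h2 : normAbs F 2 = 1) {σ : ℝ} (hσ : 1 < σ) :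
    Integrable (fun p : Fin 3 → F => (((fun q : Fin 3 → F => (max 1 (max ((normAbs F (q 0) : ℝ≥0) : ℝ) ((normAbs F (q 2) : ℝ≥0) : ℝ))) ^ (-σ) *
        (max 1 (max ((normAbs F (q 1) : ℝ≥0) : ℝ) ((normAbs F (q 2 - q 0 * q 1) : ℝ≥0) : ℝ))) ^ (-σ))
        ![p 0 + δ₁ * p 1, -(p 0 - δ₁ * p 1), δ₁ * p 2 - 2⁻¹ * (p 0 + δ₁ * p 1) * (p 0 - δ₁ * p 1)] : ℝ) : ℂ)) (Measure.pi fun _ : Fin 3 => μ) ∧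
    ∫ p : Fin 3 → F, (((fun q : Fin 3 → F => (max 1 (max ((normAbs F (q 0) : ℝ≥0) : ℝ) ((normAbs F (q 2) : ℝ≥0) : ℝ))) ^ (-σ) *
        (max 1 (max ((normAbs F (q 1) : ℝ≥0) : ℝ) ((normAbs F (q 2 - q 0 * q 1) : ℝ≥0) : ℝ))) ^ (-σ))
        ![p 0 + δ₁ * p 1, -(p 0 - δ₁ * p 1), δ₁ * p 2 - 2⁻¹ * (p 0 + δ₁ * p 1) * (p 0 - δ₁ * p 1)] : ℝ) : ℂ) ∂(Measure.pi fun _ : Fin 3 => μ) =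
      ((μ.real (primePowBall F 0) ^ 3 *
        (((1 - (residueFieldCard F : ℝ) ^ (-σ)) / (1 - (residueFieldCard F : ℝ) ^ (1 - σ))) ^ 2 *
          ((1 - (residueFieldCard F : ℝ) ^ (-(2 * σ - 1))) / (1 - (residueFieldCard F : ℝ) ^ (-(2 * σ - 2))))) : ℝ) : ℂ) := by
  refine ⟨(integrable_splitCell_pi μ hδ h2 hσ).ofReal, ?_⟩
  rw [integral_complex_ofReal, integral_splitCell_pi_eq μ hδ h2 hσ]

end Haar

end Summit.HodgeConjecture.HodgeConjecture.Cruxes.H413.K2E1IntertwiningLocalMeanSplitU3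

end
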